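import Summits.BirchSwinnertonDyer.BirchSwinnertonDyer.Theorems.ThetaPartnerAtTwoSignedKatoUpToAtTwoCuspFactorOddCharacters
import Literature.NumberTheory.EllipticCurves.RohrlichNonvanishing
import Literature.NumberTheory.EllipticCurves.PAdicLFunctionMinus
import Literature.NumberTheory.EllipticCurves.PAdicLFunctionProofs
import Literature.NumberTheory.EllipticCurves.ModularSymbolsHeckeProofs
import HarnessLib

/-!
# Route `ThetaPartnerAtTwo` (TP2), crux K3 `SignedKatoDivisibilityUpToAtTwo` (stmt-BirchSwinnertonDyer-20308 / K3P′ 25631), line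
# `colemanrat` v12 — the ODD-TWIST SUPPLY at `2`: three odd primitive characters of conductor `2^e` with non-vanishing minus twisted
# symbol sum, from Rohrlich's theorem (the input of the cusp-factor generation argument)

Width seat `bsd-wall-tp2-p2x-w2` g6 (cell `bsd-wall`). HONEST FRAMING: theorems only (no definition, no named fact, no instance, no
`sorry`); CONDITIONAL on the tree's named fact `Rohrlich1984_nonvanishing_twists` (Rohrlich 1984 = Kato's Thm. 13.5 (2)); closes no
item; K3 / K3P′ are NOT settled and BSD is NOT proved by any of this.

## Why (memo `Cruxes/SignedKatoDivisibilityUpToAtTwo/W2G6-KATO1312-AT2.md` §1 (d), §2; prequels `…CuspFactorSpan.lean`,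
## `…CuspFactorOddCharacters.lean`)

The K3 assembly reads Kato's explicit reciprocity law at `2` character by character; its `μ ∈ Λ ∖ 𝔭` is the rational four-term cusp
factor `μ̃(c,d)` built from the MINUS modular symbols `[b/2^e]⁻_f` (Kato, Astérisque 295, Thm. 6.6 with the parity cross-over; tree
`Kato2004.EulerSystemValues.cuspFactor f true …`). `CuspSpan.exists_bracket_ne_zero` reduces «some `(c,d)` has `μ̃ ∉ 𝔭`» at the
exceptional primes to THREE distinct characters `ψ` of `(ℤ/2^e)^×` with `∑_b ψ(b)[b/2^e]⁻_f ≠ 0`. Kato gets the corresponding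
non-vanishing from Rohrlich (Thm. 13.5 (2)) in §13.12. THIS FILE (`K = ℂ`): **`exists_three_odd_isPrimitive_ratMinusTwistedSymbolSum_ne_zero`**
— granting Rohrlich's named fact, for a rational newform `f` of odd level and every `e₀` there are `e ≥ e₀` and three distinct odd
primitive `ψ` mod `2^e` with `ratMinusTwistedSymbolSum f ψ ≠ 0`: by ODD Birch (tree THEOREM `ratMinusTwistedSymbolSum_mul_minusPeriod_mul_I`,
`τ(ψ) ≠ 0`, continuation `exists_differentiable_eq_twistedLSeries_holds`) a vanishing sum forces `L(f, ψ̄, 1) = 0`, i.e. `(2^e, ψ̄)` lies in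
Rohrlich's finite set; so at most `#(that set)` members of the `2^{e−3}`-family of `…CuspFactorOddCharacters` fail. Also restated in the
`(ℤ/2^e)^× →* ℂ` currency of the span lemma (`exists_three_unitHom_sum_ratMinusSymbol_ne_zero`).

References: [RohrlichInventiones1984] D. Rohrlich, Invent. Math. 75 (1984) 409–423, Theorem p. 409; [Kato2004Asterisque] K. Kato,
Astérisque 295 (2004), Thm. 13.5 (2) (p. 227), §13.12 (pp. 231–233), Lemma 13.11 (2) (p. 231); [MazurTateTeitelbaum1986Invent] §I.8 (8.6).
-/

set_option autoImplicit false
-- the Theorems namespace of this sub repeats the summit name by design (D-0017 nested layout)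
set_option linter.dupNamespace false

noncomputable section

open scoped BigOperators

open Literature.NumberTheory.EllipticCurves Literature.NumberTheory.EllipticCurves.ModularForms

namespace Summit.BirchSwinnertonDyer.BirchSwinnertonDyer.Theorems.SignedKatoOffTwo.OddTwistSupply

/-! ## §2 The supply at `2`: three odd primitive characters with non-vanishing minus twisted symbol sum (conditional on Rohrlich) -/

section Supply

variable {N : ℕ} [NeZero N] {f : CuspForm (CongruenceSubgroup.Gamma0 N) 2}

/-- **A vanishing minus twisted symbol sum is a vanishing twisted `L`-value** (odd Birch). For a rational newform `f`, an odd primitive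
`ψ` modulo `m` with `ratMinusTwistedSymbolSum f ψ = 0`, the entire continuation `L` of `L(f, ψ̄, s)` has `L(1) = 0`
(`ratMinusTwistedSymbolSum_mul_minusPeriod_mul_I`: `(∑ ψ(a)[a/m]⁻)·Ω⁻·i = τ(ψ)·L(1)`, with `τ(ψ) ≠ 0`).
[cite: MazurTateTeitelbaum1986Invent, §I.8 (8.6)] -/
theorem twistedL_one_eq_zero_of_ratMinusTwistedSymbolSum_eq_zero (hf : IsNewform0 f) (hQ : coeffField f = ⊥)
    {m : ℕ} [NeZero m] {ψ : DirichletCharacter ℂ m} (hψ : ψ.IsPrimitive) (hψo : ψ.Odd)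
    (h0 : ratMinusTwistedSymbolSum f ψ = 0)
    {L : ℂ → ℂ} (hL : Differentiable ℂ L) (hL' : ∀ s : ℂ, 2 < s.re → L s = twistedLSeries f ψ⁻¹ s) : L 1 = 0 := by
  have hB := ratMinusTwistedSymbolSum_mul_minusPeriod_mul_I f hf hQ hψ hψo hL hL'
  rw [h0, zero_mul, zero_mul] at hB
  exact (mul_eq_zero.mp hB.symm).resolve_left (gaussSum_stdAddChar_ne_zero hψ)

/-- **The odd-twist supply at `2` (conditional on Rohrlich).** Let `f ∈ S₂(Γ₀(N))` be a normalised newform with rational coefficients and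
`2 ∤ N`. Granting Rohrlich's theorem (tree named fact `Rohrlich1984_nonvanishing_twists`: only finitely many primitive `χ` of `2`-power
conductor have `L(f, χ, 1) = 0`), for every `e₀` there are `e ≥ e₀` and THREE distinct odd primitive Dirichlet characters `ψ` modulo `2^e`
with `ratMinusTwistedSymbolSum f ψ = ∑_{a mod 2^e} ψ(a)[a/2^e]⁻_f ≠ 0`. Proof: §1 gives `2^{e−3}` odd primitive characters modulo `2^e`; the
failing ones inject into Rohrlich's finite set via `ψ ↦ (2^e, ψ̄)` (`twistedL_one_eq_zero_of_ratMinusTwistedSymbolSum_eq_zero` with the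
continuation `exists_differentiable_eq_twistedLSeries_holds`); choose `e` with `2^{e−3} ≥ #set + 3`. This is Kato's use of Thm. 13.5 (2) in
§13.12, at `p = 2` and for odd characters (even characters of `Γ` see the cusps through MINUS symbols). CONDITIONAL on `hR`; closes nothing.
[cite: RohrlichInventiones1984, Theorem (p. 409)] [cite: Kato2004Asterisque, Thm. 13.5 (2) (p. 227), §13.12 (pp. 231–233)] -/
theorem exists_three_odd_isPrimitive_ratMinusTwistedSymbolSum_ne_zero (hR : Rohrlich1984_nonvanishing_twists)
    (hf : IsNewform0 f) (hQ : coeffField f = ⊥) (h2 : ¬ 2 ∣ N) (e₀ : ℕ) :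
    ∃ e : ℕ, e₀ ≤ e ∧ 3 ≤ e ∧ ∃ ψ : Fin 3 → DirichletCharacter ℂ (2 ^ e),
      Function.Injective ψ ∧ ∀ i, (ψ i).Odd ∧ (ψ i).IsPrimitive ∧ ratMinusTwistedSymbolSum f (ψ i) ≠ 0 := by
  classical
  have hfin := Rohrlich1984_nonvanishing_twists.primePow hR hf (p := 2) h2
  set Bad := hfin.toFinset with hBad
  set C := Bad.card with hC
  -- the level
  set e := e₀ + C + 6 with he
  have he3 : 3 ≤ e := by omega
  have hpow : C + 3 ≤ 2 ^ (e - 3) := by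
    have h1 : e - 3 = e₀ + C + 3 := by omega
    rw [h1]
    calc C + 3 ≤ e₀ + C + 3 := by omega
      _ ≤ 2 ^ (e₀ + C + 3) := Nat.lt_two_pow_self.le
  haveI : NeZero (2 ^ e) := ⟨pow_ne_zero _ two_ne_zero⟩
  obtain ⟨ψ, hψinj, hψ⟩ := exists_odd_isPrimitive_family ℂ he3
  -- the failing indices inject into Rohrlich's set
  let F : Finset (Fin (2 ^ (e - 3))) := Finset.univ.filter fun j ↦ ratMinusTwistedSymbolSum f (ψ j) = 0
  have hFinj : Set.InjOn (fun j : Fin (2 ^ (e - 3)) ↦ (⟨2 ^ e, (ψ j)⁻¹⟩ : Σ m : ℕ, DirichletCharacter ℂ m)) F := by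
    intro j _ j' _ hjj'
    simp only [Sigma.mk.injEq, heq_eq_eq, true_and] at hjj'
    exact hψinj (inv_injective hjj')
  have hFmaps : ∀ j ∈ F, (⟨2 ^ e, (ψ j)⁻¹⟩ : Σ m : ℕ, DirichletCharacter ℂ m) ∈ Bad := by
    intro j hj
    rw [Finset.mem_filter] at hj
    rw [hBad, Set.Finite.mem_toFinset]
    refine ⟨pow_ne_zero _ two_ne_zero, ?_, ?_, ?_⟩
    · rw [Nat.primeFactors_prime_pow (by omega) Nat.prime_two]
    · show ((ψ j)⁻¹).IsPrimitive
      rw [DirichletCharacter.isPrimitive_def, DirichletCharacter.conductor_inv]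
      exact (hψ j).2
    · obtain ⟨L, hL, hL'⟩ := exists_differentiable_eq_twistedLSeries_holds f (ψ j)⁻¹
      exact ⟨L, hL, hL', twistedL_one_eq_zero_of_ratMinusTwistedSymbolSum_eq_zero hf hQ (hψ j).2 (hψ j).1 hj.2 hL hL'⟩
  have hFcard : F.card ≤ C := by
    rw [hC]
    exact Finset.card_le_card_of_injOn _ hFmaps hFinj
  -- hence at least three good indices
  let Good : Finset (Fin (2 ^ (e - 3))) := Finset.univ.filter fun j ↦ ratMinusTwistedSymbolSum f (ψ j) ≠ 0
  have hGood : 3 ≤ Good.card := by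
    have hsplit : F.card + Good.card = 2 ^ (e - 3) := by
      have h := Finset.card_filter_add_card_filter_not (s := (Finset.univ : Finset (Fin (2 ^ (e - 3)))))
        (fun j ↦ ratMinusTwistedSymbolSum f (ψ j) = 0)
      rw [Finset.card_univ, Fintype.card_fin] at h
      exact h
    omega
  obtain ⟨t, ht, htcard⟩ := Finset.exists_subset_card_eq hGood
  let ε : Fin 3 ≃ {x // x ∈ t} := (t.equivFinOfCardEq htcard).symm
  refine ⟨e, by omega, he3, fun k ↦ ψ (ε k), ?_, fun k ↦ ⟨(hψ _).1, (hψ _).2, ?_⟩⟩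
  · intro k k' hkk'
    exact ε.injective (Subtype.ext (hψinj hkk'))
  · have hmem : ((ε k : {x // x ∈ t}) : Fin (2 ^ (e - 3))) ∈ Good := ht (ε k).2
    rw [Finset.mem_filter] at hmem
    exact hmem.2

/-- **The supply in the currency of the span lemma** (`CuspSpan.exists_bracket_ne_zero`): three distinct characters
`ψ_i : (ℤ/2^e)^× →* ℂ` with `∑_{b ∈ (ℤ/2^e)^×} ψ_i(b)·[b/2^e]⁻_f ≠ 0` (the unit sum equals `ratMinusTwistedSymbolSum`, non-units
contributing `0`). CONDITIONAL on Rohrlich; closes nothing. [cite: RohrlichInventiones1984, Theorem (p. 409)] [cite: Kato2004Asterisque, §13.12 (pp. 231–233)] -/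
theorem exists_three_unitHom_sum_ratMinusSymbol_ne_zero (hR : Rohrlich1984_nonvanishing_twists)
    (hf : IsNewform0 f) (hQ : coeffField f = ⊥) (h2 : ¬ 2 ∣ N) (e₀ : ℕ) :
    ∃ e : ℕ, e₀ ≤ e ∧ 3 ≤ e ∧ ∃ ψ : Fin 3 → ((ZMod (2 ^ e))ˣ →* ℂ),
      Function.Injective ψ ∧
        ∀ i, ∑ b : (ZMod (2 ^ e))ˣ, ψ i b * ((ratMinusSymbol f (((b : ZMod (2 ^ e)).val : ℚ) / 2 ^ e) : ℚ) : ℂ) ≠ 0 := by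
  classical
  obtain ⟨e, hee, he3, ψ, hψinj, hψ⟩ := exists_three_odd_isPrimitive_ratMinusTwistedSymbolSum_ne_zero hR hf hQ h2 e₀
  haveI : NeZero (2 ^ e) := ⟨pow_ne_zero _ two_ne_zero⟩
  refine ⟨e, hee, he3, fun i ↦ (Units.coeHom ℂ).comp (ψ i).toUnitHom, ?_, fun i ↦ ?_⟩
  · intro i i' h
    apply hψinj
    apply MulChar.ext'
    intro a
    by_cases ha : IsUnit a
    · obtain ⟨b, rfl⟩ := ha
      have := DFunLike.congr_fun h b
      simpa only [MonoidHom.coe_comp, Function.comp_apply, Units.coeHom_apply, MulChar.coe_toUnitHom] using this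
    · rw [MulChar.map_nonunit _ ha, MulChar.map_nonunit _ ha]
  · have hsum : ∑ b : (ZMod (2 ^ e))ˣ, ((Units.coeHom ℂ).comp (ψ i).toUnitHom) b *
        ((ratMinusSymbol f (((b : ZMod (2 ^ e)).val : ℚ) / 2 ^ e) : ℚ) : ℂ) = ratMinusTwistedSymbolSum f (ψ i) := by
      rw [ratMinusTwistedSymbolSum]
      simp only [MonoidHom.coe_comp, Function.comp_apply, Units.coeHom_apply, MulChar.coe_toUnitHom, Nat.cast_pow,
        Nat.cast_ofNat]
      -- non-units contribute zero
      rw [← Finset.sum_subset (Finset.subset_univ ((Finset.univ : Finset (ZMod (2 ^ e))).filter IsUnit))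
        (fun a _ ha ↦ by
          rw [Finset.mem_filter, not_and] at ha
          rw [MulChar.map_nonunit _ (ha (Finset.mem_univ a)), zero_mul])]
      refine (Finset.sum_bij (fun (b : (ZMod (2 ^ e))ˣ) _ ↦ (b : ZMod (2 ^ e))) (fun b _ ↦ by simp) (fun b _ b' _ h ↦ Units.ext h)
        (fun a ha ↦ ?_) (fun b _ ↦ rfl))
      rw [Finset.mem_filter] at ha
      obtain ⟨b, rfl⟩ := ha.2
      exact ⟨b, Finset.mem_univ _, rfl⟩
    rw [hsum]
    exact (hψ i).2.2

end Supply

end Summit.BirchSwinnertonDyer.BirchSwinnertonDyer.Theorems.SignedKatoOffTwo.OddTwistSupply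

end
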